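import Literature.AlgebraicGeometry.Frobenioids.ArchimedeanData
import Mathlib.Analysis.SpecialFunctions.Complex.Arg
import HarnessLib

/-!
# Frobenioids II, Definition 3.1 (iii): the tensor product of angular regions is an angular region

Mochizuki, *The geometry of Frobenioids II*, Kyushu J. Math. **62** (2008) 401–460, §3 Definition 3.1
(iii), author's text p. 24 [cite: MochizukiFrdII2008, Def 3.1 (iii) p.24]: "if, for `i = 1, 2`, `Vᵢ` is a
one-dimensional `K`-vector space, and `Aᵢ ⊆ Vᵢ` is an angular region, then one verifies immediately
that `A₁ ⊗_K A₂ := {a₁ ⊗ a₂ | a₁ ∈ A₁, a₂ ∈ A₂} ⊆ V₁ ⊗_K V₂` is an angular region". The statement file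
`ArchimedeanData.lean` (seat abc-iut-L1-t4) records this, for `Vᵢ = K`, as the named fact
`ArchFrd.TensorOfAngularRegions K`: the product set of two angular regions of `K^×` is an angular region.

This proof-only file discharges it (`tensorOfAngularRegions_holds`). The verification: with
`Aᵢ = Bᵢ × (0, λᵢ]` in the polar decomposition `K^× = O_K^× × ℝ_{>0}` (`unitDecomposition`), the product set
is `(B₁ B₂) × (0, λ₁ λ₂]` (an element of absolute value `r ≤ λ₁ λ₂` and unit part `b₁ b₂` is
`(b₁ λ₁) · (b₂ · r/λ₁)`); `B₁ B₂` is open; and it meets every connected component of `O_K^×` in a nonempty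
connected set because, by the dichotomy `RCLike.I = 0` / `im I = 1` (Mathlib `RCLike.I_eq_zero_or_im_I_eq_one`),
either `O_K^× = {±1}` is finite, hence totally disconnected, so that `B₁ = B₂ = O_K^×` (the file's
`isIsotropic_of_totallyDisconnected`), or `O_K^×` is the continuous image `t ↦ e⁻¹(exp(it))` of `ℝ` under
the isometric ring isomorphism `e : K ≃ ℂ` (`RCLike.complexRingEquiv`), hence connected, so that `B₁`, `B₂`
and their product `B₁ B₂ = mul(B₁ × B₂)` are connected. No statement of the paper is strengthened.
-/

namespace Literature.AlgebraicGeometry.Frobenioids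

open Function Set Topology
open scoped Pointwise

namespace ArchFrd

variable {K : Type*} [RCLike K]

/-! ### Polar coordinates: unit part and absolute value of products -/

/-- In polar coordinates `(z, x) ↦ z · x`, the unit part of `z · x` is `z` and its absolute value is `x`.
[cite: MochizukiFrdII2008, Def 3.1 (ii) pp.23-24] -/
theorem unitPart_absHom_polar (z : normOneSubgroup K) (x : PosReal) :
    unitPart K ((z : Kˣ) * ofPosReal K x) = z ∧ absHom K ((z : Kˣ) * ofPosReal K x) = x := by
  have e := Prod.ext_iff.mp ((unitDecomposition K).symm_apply_apply (z, x))
  exact ⟨e.1, e.2⟩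

/-- The unit part `u ↦ u/|u|` is multiplicative (the polar decomposition is a group isomorphism).
[cite: MochizukiFrdII2008, Def 3.1 (ii) pp.23-24] -/
theorem unitPart_mul (u v : Kˣ) : unitPart K (u * v) = unitPart K u * unitPart K v :=
  congrArg Prod.fst (map_mul (unitDecomposition K).symm u v)

/-- `u = (u/|u|) · |u|`. [cite: MochizukiFrdII2008, Def 3.1 (ii) pp.23-24] -/
theorem unitPart_mul_ofPosReal_absHom (u : Kˣ) : (unitPart K u : Kˣ) * ofPosReal K (absHom K u) = u :=
  (unitDecomposition K).apply_symm_apply u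

/-! ### The real case: `O_K^× = {±1}` -/

/-- If `RCLike.I = 0` (the real case), an element of `O_K^×` is `1` or `-1`.
[cite: MochizukiFrdII2008, Def 3.1 (iii) p.24] -/
theorem coe_normOneSubgroup_eq_or (hI : RCLike.I = (0 : K)) (z : normOneSubgroup K) :
    ((z : Kˣ) : K) = 1 ∨ ((z : Kˣ) : K) = -1 := by
  have hz : ‖((z : Kˣ) : K)‖ = 1 := z.2
  have hre : ((RCLike.re ((z : Kˣ) : K) : ℝ) : K) = ((z : Kˣ) : K) := by
    have h := RCLike.re_add_im ((z : Kˣ) : K)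
    rw [RCLike.im_eq_zero hI, RCLike.ofReal_zero, zero_mul, add_zero] at h
    exact h
  rw [← hre, RCLike.norm_ofReal] at hz
  rcases (abs_eq zero_le_one).mp hz with h | h
  · left
    rw [← hre, h, RCLike.ofReal_one]
  · right
    rw [← hre, h, RCLike.ofReal_neg, RCLike.ofReal_one]

/-- If `RCLike.I = 0`, then `O_K^×` is finite ("`B = O_K^×` whenever `K` is real", FrdII p. 24, rests on
`O_ℝ^× = {±1}`). [cite: MochizukiFrdII2008, Def 3.1 (iii) p.24] -/
theorem finite_normOneSubgroup (hI : RCLike.I = (0 : K)) : Finite (normOneSubgroup K) := by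
  have hneg : (-1 : Kˣ) ∈ normOneSubgroup K := by
    rw [mem_normOneSubgroup_iff, Units.val_neg, Units.val_one, norm_neg, norm_one]
  refine Finite.of_surjective (fun b : Bool => if b then (1 : normOneSubgroup K) else ⟨-1, hneg⟩) fun z => ?_
  rcases coe_normOneSubgroup_eq_or hI z with h | h
  · refine ⟨true, Subtype.ext (Units.ext ?_)⟩
    simp only [if_true, OneMemClass.coe_one, Units.val_one]
    exact h.symm
  · refine ⟨false, Subtype.ext (Units.ext ?_)⟩
    simp only [Bool.false_eq_true, if_false, Units.val_neg, Units.val_one]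
    exact h.symm

/-! ### The complex case: `O_K^×` is connected -/

/-- If `im I = 1` (the complex case), `O_K^×` is a connected topological space: it is the image of `ℝ` under
`t ↦ e⁻¹(exp(it))`, `e : K ≃ ℂ` the canonical isometric ring isomorphism; hence every connected component
is all of `O_K^×`. [cite: MochizukiFrdII2008, Def 3.1 (iii) p.24] -/
theorem connectedComponent_normOneSubgroup_eq_univ (hI : RCLike.im (RCLike.I : K) = 1)
    (z : normOneSubgroup K) : connectedComponent z = univ := by
  set e : K ≃+* ℂ := RCLike.complexRingEquiv hI with he
  have hn : ∀ x : K, ‖e x‖ = ‖x‖ := fun x => (RCLike.complexLinearIsometryEquiv hI).norm_map x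
  have hn' : ∀ w : ℂ, ‖e.symm w‖ = ‖w‖ := fun w => by rw [← hn (e.symm w), e.apply_symm_apply]
  -- the parametrisation `t ↦ e⁻¹(exp(it))`
  have hexp : ∀ t : ℝ, e.symm (Complex.exp (t * Complex.I)) ≠ 0 := fun t =>
    (map_ne_zero_iff e.symm e.symm.injective).2 (Complex.exp_ne_zero _)
  have hcK : Continuous fun w : ℂ => e.symm w := by
    have : (fun w : ℂ => e.symm w) = fun w => ((w.re : ℝ) : K) + ((w.im : ℝ) : K) * RCLike.I := by
      funext w
      rw [he, RCLike.complexRingEquiv_symm_apply]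
    rw [this]
    exact ((RCLike.continuous_ofReal.comp Complex.continuous_re).add
      ((RCLike.continuous_ofReal.comp Complex.continuous_im).mul continuous_const))
  have hcexp : Continuous fun t : ℝ => Complex.exp (t * Complex.I) :=
    Complex.continuous_exp.comp (Complex.continuous_ofReal.mul continuous_const)
  have hval : Continuous fun t : ℝ => e.symm (Complex.exp (t * Complex.I)) := hcK.comp hcexp
  let g : ℝ → Kˣ := fun t => Units.mk0 (e.symm (Complex.exp (t * Complex.I))) (hexp t)
  have hg : Continuous g := by
    refine Units.continuous_iff.2 ⟨hval, ?_⟩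
    have : (fun t => ((g t)⁻¹ : Kˣ).val) = fun t : ℝ => (e.symm (Complex.exp ((t : ℂ) * Complex.I)))⁻¹ := by
      funext t
      rw [Units.val_inv_eq_inv_val, Units.val_mk0]
    rw [this]
    exact hval.inv₀ hexp
  have hmem : ∀ t, g t ∈ normOneSubgroup K := fun t => by
    rw [mem_normOneSubgroup_iff, Units.val_mk0, hn', Complex.norm_exp_ofReal_mul_I]
  let F : ℝ → normOneSubgroup K := fun t => ⟨g t, hmem t⟩
  have hF : Continuous F := hg.subtype_mk hmem
  -- it is surjective: `w = exp(i arg w)` for `|w| = 1`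
  have hsurj : Function.Surjective F := fun y => by
    set w : ℂ := e ((y : Kˣ) : K) with hw
    have hw1 : ‖w‖ = 1 := by rw [hw, hn]; exact y.2
    refine ⟨Complex.arg w, Subtype.ext (Units.ext ?_)⟩
    have hexpw : Complex.exp ((Complex.arg w : ℝ) * Complex.I) = w := by
      have := Complex.norm_mul_exp_arg_mul_I w
      rwa [hw1, Complex.ofReal_one, one_mul] at this
    change e.symm (Complex.exp ((Complex.arg w : ℝ) * Complex.I)) = ((y : Kˣ) : K)
    rw [hexpw, hw, e.symm_apply_apply]
  have hpre : IsPreconnected (univ : Set (normOneSubgroup K)) := by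
    rw [← hsurj.range_eq]
    exact (isConnected_range hF).isPreconnected
  exact Set.eq_univ_of_univ_subset (hpre.subset_connectedComponent (Set.mem_univ z))

/-! ### The named fact -/

variable (K)

/-- **[FrdII] Definition 3.1 (iii)**, last sentence, discharged: the product set of two angular regions
`A₁ = B₁ × (0, λ₁]`, `A₂ = B₂ × (0, λ₂]` of `K^×` is the angular region `(B₁ B₂) × (0, λ₁ λ₂]` (FrdII p. 24,
"one verifies immediately that `A₁ ⊗_K A₂` … is an angular region"). [cite: MochizukiFrdII2008, Def 3.1 (iii) p.24] -/
theorem tensorOfAngularRegions_holds : TensorOfAngularRegions K := by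
  intro A₁ A₂
  -- `B₁ B₂` meets every connected component of `O_K^×` in a nonempty connected set
  have hconn : ∀ z : normOneSubgroup K, IsConnected ((A₁.dir * A₂.dir) ∩ connectedComponent z) := by
    rcases RCLike.I_eq_zero_or_im_I_eq_one (K := K) with hI | hI
    · -- real case: `O_K^×` finite, so both angular parts are all of `O_K^×`
      haveI := finite_normOneSubgroup hI
      have h₁ : A₁.dir = univ := A₁.isIsotropic_of_totallyDisconnected
      have h₂ : A₂.dir = univ := A₂.isIsotropic_of_totallyDisconnected
      intro z
      rw [h₁, h₂, Set.univ_mul_univ, Set.univ_inter]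
      exact isConnected_connectedComponent
    · -- complex case: `O_K^×` connected, product of connected sets connected
      intro z
      have hz := connectedComponent_normOneSubgroup_eq_univ hI
      have h₁ : IsConnected A₁.dir := by simpa only [hz, Set.inter_univ] using A₁.isConnected_inter z
      have h₂ : IsConnected A₂.dir := by simpa only [hz, Set.inter_univ] using A₂.isConnected_inter z
      rw [hz, Set.inter_univ, ← Set.image_mul_prod]
      exact (h₁.prod h₂).image _ continuous_mul.continuousOn
  refine ⟨AngularRegion.mk (A₁.dir * A₂.dir) (A₁.tip * A₂.tip) A₂.isOpen_dir.mul_left hconn, ?_⟩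
  ext u
  change unitPart K u ∈ A₁.dir * A₂.dir ∧ absHom K u ≤ A₁.tip * A₂.tip ↔ u ∈ A₁.carrier * A₂.carrier
  constructor
  · rintro ⟨hdir, hle⟩
    obtain ⟨d₁, hd₁, d₂, hd₂, hd⟩ := Set.mem_mul.mp hdir
    refine Set.mem_mul.mpr ⟨(d₁ : Kˣ) * ofPosReal K A₁.tip, ⟨?_, ?_⟩,
      (d₂ : Kˣ) * ofPosReal K (absHom K u * A₁.tip⁻¹), ⟨?_, ?_⟩, ?_⟩
    · rw [(unitPart_absHom_polar d₁ _).1]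
      exact hd₁
    · rw [(unitPart_absHom_polar d₁ _).2]
    · rw [(unitPart_absHom_polar d₂ _).1]
      exact hd₂
    · rw [(unitPart_absHom_polar d₂ _).2, mul_inv_le_iff_le_mul, mul_comm]
      exact hle
    · calc (d₁ : Kˣ) * ofPosReal K A₁.tip * ((d₂ : Kˣ) * ofPosReal K (absHom K u * A₁.tip⁻¹))
          = ((d₁ * d₂ : normOneSubgroup K) : Kˣ) * ofPosReal K (A₁.tip * (absHom K u * A₁.tip⁻¹)) := by
            rw [map_mul (ofPosReal K) A₁.tip, Subgroup.coe_mul]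
            simp only [mul_assoc, mul_left_comm (ofPosReal K A₁.tip)]
        _ = (unitPart K u : Kˣ) * ofPosReal K (absHom K u) := by
            rw [hd, mul_comm (absHom K u), mul_inv_cancel_left]
        _ = u := unitPart_mul_ofPosReal_absHom u
  · rintro ⟨u₁, ⟨h₁d, h₁t⟩, u₂, ⟨h₂d, h₂t⟩, rfl⟩
    refine ⟨?_, ?_⟩
    · rw [unitPart_mul]
      exact Set.mul_mem_mul h₁d h₂d
    · rw [map_mul]
      exact mul_le_mul' h₁t h₂t

/-- `TensorOfAngularRegions` — `_holds` alias of `tensorOfAngularRegions_holds` above under the fact's exact name (appended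
2026-08-28, D-0026 bookkeeping: the proof term is the existing theorem of this file; no statement,
definition or attribute is edited; no new named fact; the ledger's debt table listed the fact
unproved). [cite: MochizukiFrdII2008, Def 3.1 (iii) p.24] -/
theorem _root_.Literature.AlgebraicGeometry.Frobenioids.ArchFrd.TensorOfAngularRegions_holds :
    TensorOfAngularRegions K :=
  _root_.Literature.AlgebraicGeometry.Frobenioids.ArchFrd.tensorOfAngularRegions_holds (K := K)

end ArchFrd

end Literature.AlgebraicGeometry.Frobenioids
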